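import Summits.BirchSwinnertonDyer.BirchSwinnertonDyer.Theses.TangentCone
import Literature.Barriers.BirchSwinnertonDyer.DescentDefectUnboundedKramerHoldsProofs

/-!
# BirchSwinnertonDyer — crux `SelmerRankShaPFinite` (stmt-BirchSwinnertonDyer-0132):
# negative lemma — the torsion layers `Ш[n]` do not control `Ш[p^∞]` (standing disprover, cycle 1)

What the tree PROVES about Ш of an elliptic curve over a number field is the finiteness of every
torsion layer `Ш(E/K)[n]`, `n ≠ 0` (`Literature.Barriers.BirchSwinnertonDyer.finite_shaTorsion`,
Silverman AEC X.4.2(b) via the finite `n`-Selmer group). The crux asks for the finiteness of the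
`p`-PRIMARY component. This file shows, kernel-checked, that the gap is real at the level of
abstract abelian groups: `ℚ/ℤ = AddCircle (1 : ℚ)` has every torsion layer finite and every
`p`-primary component (the Prüfer group) infinite. Hence no proof can close the crux from the
finiteness of the `Ш[n]` by group theory alone; its entire content is the vanishing of the
divisible part of `Ш[p^∞]` (equivalently, by the census dictionary of
`Cruxes/SelmerRankShaPFinite/STRATEGY-CENSUS.md`, `corank_ℤₚ Sel_p∞(E/ℚ) ≤ rank E(ℚ)`).
No route statement is asserted; no definition is introduced.
Full adversarial record: `Cruxes/SelmerRankShaPFinite/Disproof.lean`.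
-/

set_option linter.dupNamespace false

noncomputable section

open scoped Classical

namespace Summit.BirchSwinnertonDyer.BirchSwinnertonDyer.Theorems

open Literature.Barriers.BirchSwinnertonDyer
open WeierstrassCurve

/-- In `ℚ/ℤ = AddCircle (1 : ℚ)` every torsion layer `A[n]`, `n > 0`, is finite (it is the union
over `d ∣ n` of the finitely many elements of order `d`). [folklore] -/
theorem selmerRankShaPFinite_finite_torsionBy_addCircle (n : ℕ) (hn : 0 < n) :
    Finite ↥(AddSubgroup.torsionBy (AddCircle (1 : ℚ)) (n : ℤ)) := by
  have hsub : ((AddSubgroup.torsionBy (AddCircle (1 : ℚ)) (n : ℤ)) : Set (AddCircle (1 : ℚ))) ⊆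
      ⋃ d ∈ n.divisors, {u : AddCircle (1 : ℚ) | addOrderOf u = d} := by
    intro u hu
    have hu' : (n : ℤ) • u = 0 := hu
    rw [natCast_zsmul] at hu'
    simp only [Set.mem_iUnion, Set.mem_setOf_eq, exists_prop]
    exact ⟨addOrderOf u, Nat.mem_divisors.mpr ⟨addOrderOf_dvd_of_nsmul_eq_zero hu', hn.ne'⟩, rfl⟩
  have hfin : (⋃ d ∈ n.divisors, {u : AddCircle (1 : ℚ) | addOrderOf u = d}).Finite := by
    refine Set.Finite.biUnion (Finset.finite_toSet _) fun d hd => ?_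
    exact AddCircle.finite_setOf_addOrderOf_eq (1 : ℚ) (Nat.pos_of_mem_divisors hd)
  exact (hfin.subset hsub).to_subtype

/-- In `ℚ/ℤ` the `p`-primary component (the Prüfer group `ℚ_p/ℤ_p`) is infinite: the classes of
`1/p^k` have the pairwise distinct orders `p^k`. [folklore] -/
theorem selmerRankShaPFinite_not_finite_primaryComponent_addCircle (p : ℕ) [hp : Fact p.Prime] :
    ¬ Finite ↥(AddCommGroup.primaryComponent (AddCircle (1 : ℚ)) p) := by
  haveI : Fact ((0 : ℚ) < 1) := ⟨one_pos⟩
  let f : ℕ → AddCircle (1 : ℚ) := fun k => (((1 : ℚ) / ((p ^ k : ℕ) : ℚ) : ℚ) : AddCircle (1 : ℚ))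
  have hord : ∀ k, addOrderOf (f k) = p ^ k := fun k =>
    AddCircle.addOrderOf_period_div (pow_pos hp.out.pos k)
  have hmem : ∀ k, f k ∈
      (AddCommGroup.primaryComponent (AddCircle (1 : ℚ)) p : Set (AddCircle (1 : ℚ))) :=
    fun k => (AddCommGroup.mem_primaryComponent_iff_addOrderOf).mpr ⟨k, hord k⟩
  have hinj : Function.Injective f := by
    intro k l hkl
    have := congrArg addOrderOf hkl
    rw [hord, hord] at this
    exact Nat.pow_right_injective hp.out.two_le this
  have hinf := Set.infinite_of_injective_forall_mem hinj hmem
  intro hfin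
  exact hinf (Set.toFinite _)

/-- **Torsion layers do not control the primary component** (the content of `SelmerRankShaPFinite`
is the divisible part): it is NOT true that an abelian group all of whose torsion layers `A[n]`
(`n > 0`) are finite has finite `p`-primary components — `ℚ/ℤ` is a witness at every prime. For
`A = Ш(E/ℚ)` the hypothesis is the tree theorem `finite_shaTorsion` (AEC X.4.2(b)), so the crux is
not a group-theoretic consequence of what is proved about Ш. [folklore] -/
theorem selmerRankShaPFinite_not_of_finite_torsionLayers_abstract :
    ¬ ∀ (A : Type) [AddCommGroup A] (p : ℕ) [Fact p.Prime],
        (∀ n : ℕ, 0 < n → Finite ↥(AddSubgroup.torsionBy A (n : ℤ))) →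
          Finite ↥(AddCommGroup.primaryComponent A p) := by
  intro h
  haveI : Fact (Nat.Prime 2) := ⟨Nat.prime_two⟩
  exact selmerRankShaPFinite_not_finite_primaryComponent_addCircle 2
    (h (AddCircle (1 : ℚ)) 2 selmerRankShaPFinite_finite_torsionBy_addCircle)

/-- The hypothesis of the previous lemma DOES hold for Ш of every elliptic curve over `ℚ` (tree
theorem `finite_shaTorsion`, Kramer-barrier proofs file; AEC X.4.2(b)): every layer `Ш(E/ℚ)[n]`,
`n > 0`, is finite — so exactly the divisible part separates the known from the crux.
[cite: SilvermanAEC2009, Thm. X.4.2(b)] -/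
theorem selmerRankShaPFinite_finite_shaTorsion_layers (W : WeierstrassCurve ℚ) [W.IsElliptic]
    (n : ℕ) (hn : 0 < n) : Finite ↥(shaTorsion W (n : ℤ)) :=
  finite_shaTorsion W (by exact_mod_cast hn.ne')

end Summit.BirchSwinnertonDyer.BirchSwinnertonDyer.Theorems

end
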